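import Summits.HubbardSuperconductivity.HubbardSuperconductivity.Theses.ProjectedBCSGas
import HarnessLib

/-!
# Crux `RVBShadowing` (stmt-HubbardSuperconductivity-1234; route `ProjectedBCSGas`, rank 3 — the declared CONDITION of
that conditional bridge) — BIRTH SKELETON `Lines/birth.lean` (BC3, skeleton-register)

THE CRUX (fixed; `Theses/ProjectedBCSGas.lean`, decl `RVBShadowing`; never restated or weakened here): for some
`U > 0`, `δ ∈ (0,1/2)`, one member `χ[g,Δv,μ,δ]` (`g ∈ [0,1]`, `Δv ∈ (0,4]`, `μ ∈ [-4,4]`) of the projected-BCS trial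
family and some `η ∈ [0,1)`: `∀ ε > 0 ∃ R L₀` such that EVERY normalised `(N_L, S^z=0)`-sector ground state `ψ_L`
of `hubbardTorus 2 L 1 U` (even `L ≥ L₀`) has `|G_ψ(x,y) - G_χ(x,y)| ≤ η |G_χ(x,y)| + ε` at all `‖x-y‖_∞ ≥ R`,
`G = pairFieldCorr dWaveFormFactor`.

THE LINE ("amplitude form"; answers the gen-2 route review fee09c2d-g2, which observed that with `R, L₀` chosen
after `η, ε` only large-distance asymptotics matter): cut the crux at its one natural joint — the trial state's
own tail behaviour (wavefunction mathematics) versus the comparison of the true ground states with it (physics):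

1. `stub_familyTailLimit : Sig.stub_familyTailLimit` — every member of the family has a uniform large-distance
   LIMIT `A(g,Δv,μ,δ)` of its d-wave pair correlator (clustering of `|χ|²`; theorem-grade, open; shares its
   technology with the supports of crux `ProjectedBCSPairLRO`: Wick + ensemble equivalence at `g = 1`,
   `(1-g²)`-expansion, loop gas).
2. `stub_groundStateCone : Sig.stub_groundStateCone` — THE BET: for some `(U, δ)`, member and `η < 1`, whenever
   `A` is such a limit, every sector ground state's pair-correlation tail lies in the `(1±η)`-cone of the NUMBER
   `A` (up to `ε`).

COMPOSITION `RVBShadowing_of : Sig.stub_familyTailLimit → Sig.stub_groundStateCone → RVBShadowing` (a real proof,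
no `sorry`): stub 2 supplies the parameters, stub 1 the limit `A` of the chosen member, stub 2 the cone around `A`,
and an `ε/2 + ε/4 + η·ε/4` triangle (`cone_triangle`) turns "`G_ψ` in the cone of `A`" + "`G_χ` near `A`" into
the crux's `|G_ψ - G_χ| ≤ η|G_χ| + ε`; `RVBShadowing_proof : RVBShadowing` instantiates it with the two registered
stubs (its only `sorryAx` dependence is through them). The stub signatures are the `Prop`s `Sig.stub_<name>`
(pattern of `Cruxes/BindingWalk/Lines/birth.lean`), stated over existing declarations plus the local abbreviation
`trialState` (= the crux's own `χ` term, parameters abstracted; not a new notion).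

DISPROOF USED: no `Cruxes/RVBShadowing/Disproof.lean` exists (2026-08-17, `ledger crux ls`: no workfiles before this
one); no landed `Theorems/**/Negative` lemma mentions `RVBShadowing`; `ledger negatives --problem
HubbardSuperconductivity` (2 entries: `not_breathingSelfDual`, `AposterioriCapRgKlsOrderOpenness_refuted`) has no
statement about the trial family or pair-correlator shadowing. Nothing to honour beyond the route reviews (the
summit's hypothesis block typed verbatim — kept in stub 2).

BC3 PROBES (folder `bc/bc3_probes.lean`, quoted in `Lines/birth.md`): for each stub `S ∈ {Sig.stub_familyTailLimit,
Sig.stub_groundStateCone}` both `S → RVBShadowing` and `S → HubbardSuperconductivity` by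
`first | exact? | simpa [S] | (unfold S; simpa) | aesop` FAIL — neither stub is cheaply the crux or the summit.
-/
noncomputable section

-- `dupNamespace`: the summit and the problem are both named `HubbardSuperconductivity` (layout D-0022)
set_option linter.dupNamespace false
set_option linter.style.longLine false

namespace Summit.HubbardSuperconductivity.HubbardSuperconductivity.Cruxes.RVBShadowing.Birth

open Matrix Finset Filter
open Literature.Probability.LatticeModels Literature.MathematicalPhysics.QuantumLattice
open scoped ComplexOrder Matrix Classical

/-! ## The trial family and the two stub signatures -/

/-- **The route's trial family, named** (a local abbreviation, NOT a new notion): `trialState g Δv μ δ` is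
VERBATIM the `let χ := fun L => …` term of the crux `RVBShadowing` (and of `ProjectedBCSPairLRO`) with its four
parameters abstracted — the partially Gutzwiller-projected (`P_g = g^{#doublons}`), number-projected
(`N_L = 2⌊(1-δ)L²/2⌋`) d-wave BCS state `normalise (P_g P_{N_L} Π_k (u_k + v_k b_k†) |0⟩)` on the even torus
`(ℤ/Lℤ)²`, gap `Δ_k = Δv (cos k₁ - cos k₂)`, band `ξ_k = -2(cos k₁ + cos k₂) - μ`. One δ-unfolding of
`trialState` gives the crux's term syntactically, which is what the composition below relies on. [folklore] -/
def trialState (g Δv μ δ : ℝ) : (L : ℕ) → Fock (Orb (FermionTorus 2 L)) :=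
  fun L => let N : ℕ := 2 * ⌊(1 - δ) * (L : ℝ) ^ 2 / 2⌋₊; let kc : FermionTorus 2 L → Fin 2 → ℝ := fun n i => Real.cos (2 * Real.pi * ((ofLex n i : ℕ) : ℝ) / L); let ξ : FermionTorus 2 L → ℝ := fun n => -2 * (kc n 0 + kc n 1) - μ; let Δ : FermionTorus 2 L → ℝ := fun n => Δv * (kc n 0 - kc n 1); let E : FermionTorus 2 L → ℝ := fun n => Real.sqrt (ξ n ^ 2 + Δ n ^ 2); let u : FermionTorus 2 L → ℝ := fun n => Real.sqrt ((1 + ξ n / E n) / 2); let v : FermionTorus 2 L → ℝ := fun n => (if 0 ≤ Δ n then 1 else -1) * Real.sqrt ((1 - ξ n / E n) / 2); let θ : FermionTorus 2 L → FermionTorus 2 L → ℝ := fun n x => 2 * Real.pi * (((ofLex n 0 : ℕ) * (ofLex x 0 : ℕ) + (ofLex n 1 : ℕ) * (ofLex x 1 : ℕ) : ℕ) : ℝ) / L; let b : FermionTorus 2 L → Matrix (Finset (Orb (FermionTorus 2 L))) (Finset (Orb (FermionTorus 2 L))) ℂ := fun n => ∑ x : FermionTorus 2 L, ∑ y : FermionTorus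 2 L, (Complex.exp (Complex.I * ((θ n x - θ n y : ℝ) : ℂ)) / (L : ℂ) ^ 2) • (creation (orb x 0) * creation (orb y 1)); let bcs : Fock (Orb (FermionTorus 2 L)) := ((Finset.univ : Finset (FermionTorus 2 L)).toList.map (fun n => ((u n : ℝ) : ℂ) • (1 : Matrix (Finset (Orb (FermionTorus 2 L))) (Finset (Orb (FermionTorus 2 L))) ℂ) + ((v n : ℝ) : ℂ) • b n)).prod *ᵥ vacuum; let raw : Fock (Orb (FermionTorus 2 L)) := fun s => (if s.card = N then (g : ℂ) ^ (Finset.univ.filter (fun x : FermionTorus 2 L => orb x 0 ∈ s ∧ orb x 1 ∈ s)).card else 0) * bcs s; (((Real.sqrt ((star raw ⬝ᵥ raw).re))⁻¹ : ℝ) : ℂ) • raw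

/-- **Signature of STUB 1 `stub_familyTailLimit` — TAIL LIMIT OF THE TRIAL FAMILY** (wavefunction
mathematics, open but of theorem grade; the clustering companion of crux `ProjectedBCSPairLRO`). For EVERY member `χ[g,Δv,μ,δ]`
(`g ∈ [0,1]`, `Δv ∈ (0,4]`, `μ ∈ [-4,4]`, `δ ∈ (0,1/2)`) of the trial family the d-wave pair correlator
`G_χ = pairFieldCorr dWaveFormFactor χ` has a UNIFORM LARGE-DISTANCE LIMIT `A = A(g,Δv,μ,δ)`:
`∀ ε > 0 ∃ R L₀, |G_χ(x,y) - A| ≤ ε` for all even `L ≥ L₀` and all `‖x-y‖_∞ ≥ R` — asymptotic flatness of the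
tail, uniformly in the direction and in the volume (`A = Φ_d(χ)²`, the squared d-wave pair amplitude of the
member). Mechanism: clustering of the positive measure `|χ|²` (two-species determinantal/Pfaffian gas tilted by
`g^{2D}`): at `g = 1` Wick + equivalence of ensembles gives `G_χ → |F_d|²` with a power-law (nodal) connected
part; for `g < 1` the `(1-g²)`-cluster expansion of the gossamer window resp. the loop-gas picture at `g = 0`.
Why it might fail: non-summable nodal tails spoil UNIFORMITY in `L` (finite-size drift of the amplitude along
even `L`), or the projected state at atypical `N_L` (band-edge `μ`) has an `L`-dependent amplitude with no limit.
Size: L (a genuine clustering theorem; provable corner `g = 1` first). Why it is NOT the crux / the summit: it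
speaks of the trial states only — no Hubbard ground state occurs. Sources: ParamekantiRanderiaTrivedi2004,
Gros1989, MetznerVollhardt1988, GebhardVollhardt1987, YangODLRO1962. -/
def Sig.stub_familyTailLimit : Prop :=
  ∀ g ∈ Set.Icc (0 : ℝ) 1, ∀ Δv ∈ Set.Ioc (0 : ℝ) 4, ∀ μ ∈ Set.Icc (-4 : ℝ) 4, ∀ δ ∈ Set.Ioo (0 : ℝ) (1 / 2),
    ∃ A : ℝ, ∀ ε > (0 : ℝ), ∃ R L₀ : ℕ, ∀ L : ℕ, Even L → L₀ ≤ L → ∀ x y : TorusSite 2 L,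
        R ≤ torusDist x y → |pairFieldCorr dWaveFormFactor (trialState g Δv μ δ) L x y - A| ≤ ε

/-- **Signature of STUB 2 `stub_groundStateCone` — AMPLITUDE SHADOWING (the physical hypothesis, amplitude
form)**. For some `U > 0`, `δ ∈ (0,1/2)`, one member `χ[g,Δv,μ,δ]` of the family and some relative slack
`η ∈ [0,1)`: WHENEVER a real number `A` is a uniform large-distance limit of the member's d-wave pair correlator
(the tail-limit clause of stub 1, taken here as a HYPOTHESIS on `A`), the d-wave pair correlator of EVERY
normalised `(N_L, S^z = 0)`-sector ground state `ψ_L` of `hubbardTorus 2 L 1 U` (hypothesis block VERBATIM the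
summit statement's) lies in the `(1 ± η)`-cone of that NUMBER at large distance:
`∀ ε > 0 ∃ R L₀, |G_ψ(x,y) - A| ≤ η|A| + ε` for even `L ≥ L₀`, `‖x-y‖_∞ ≥ R`. This is the crux with the
fluctuating comparison function `G_χ(x,y)` replaced by its asymptotic amplitude `A = Φ_RVB²` — "the true
ground-state pair-correlation tail sits in the band `[(1-η)Φ_RVB², (1+η)Φ_RVB²]`", i.e. exactly the two numbers a
DMRG-vs-VMC comparison measures; given stub 1 it is equivalent to the crux (transfer to amplitude form) and it
carries all the physics; WITHOUT stub 1 it does not give the crux (no limit `A` need exist — stub 1 is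
load-bearing). Why it might fail: the crux's own why-might-fail — pure `t' = 0` ground states striped /
pair-density-wave modulated at the accessible `(U, δ)` (QinEtAl2020, XuEtAl2024), or a ground-state amplitude band
wider than any `(1 ± η)`-cone (degeneracy-dependent tails). Size: crux-sized (no rigorous technology; refuters
attack it by amplitude bounds). Sources: AndersonEtAl2004, ParamekantiRanderiaTrivedi2004, Anderson1987,
ZhangEtAl1988, QinEtAl2020, XuEtAl2024. -/
def Sig.stub_groundStateCone : Prop :=
  ∃ U > (0 : ℝ), ∃ δ ∈ Set.Ioo (0 : ℝ) (1 / 2), ∃ g ∈ Set.Icc (0 : ℝ) 1, ∃ Δv ∈ Set.Ioc (0 : ℝ) 4,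
    ∃ μ ∈ Set.Icc (-4 : ℝ) 4, ∃ η ∈ Set.Ico (0 : ℝ) 1,
    ∀ A : ℝ, (∀ ε > (0 : ℝ), ∃ R L₀ : ℕ, ∀ L : ℕ, Even L → L₀ ≤ L → ∀ x y : TorusSite 2 L,
        R ≤ torusDist x y → |pairFieldCorr dWaveFormFactor (trialState g Δv μ δ) L x y - A| ≤ ε) →
      ∀ ε > (0 : ℝ), ∃ R L₀ : ℕ, ∀ (N : ℕ → ℕ) (ψ : (L : ℕ) → Fock (Orb (FermionTorus 2 L))),
        (∀ L, Even L → N L = 2 * ⌊(1 - δ) * (L : ℝ) ^ 2 / 2⌋₊ ∧ star (ψ L) ⬝ᵥ ψ L = 1 ∧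
            IsGroundStateInSector (hubbardTorus 2 L 1 U) (N L) 0 (ψ L)) →
          ∀ L : ℕ, Even L → L₀ ≤ L → ∀ x y : TorusSite 2 L, R ≤ torusDist x y →
            |pairFieldCorr dWaveFormFactor ψ L x y - A| ≤ η * |A| + ε

/-! ## Arithmetic of the cone -/

/-- **Cone triangle** (pure real arithmetic used by the composition): a point `p` in the `(1 ± η)`-cone of
an amplitude `A` up to `ε/2`, and a point `q` within `ε/4` of `A`, give `p` in the `(1 ± η)`-cone of `q` up to `ε`
(for `0 ≤ η ≤ 1`, `0 ≤ ε`). [folklore] -/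
theorem cone_triangle {p q A η ε : ℝ} (hη0 : 0 ≤ η) (hη1 : η ≤ 1) (hε : 0 ≤ ε)
    (h1 : |p - A| ≤ η * |A| + ε / 2) (h2 : |q - A| ≤ ε / 4) :
    |p - q| ≤ η * |q| + ε := by
  have e1 : |p - q| ≤ |p - A| + |A - q| := abs_sub_le p A q
  have e2 : |A - q| = |q - A| := abs_sub_comm A q
  have e3 : |A| - |q| ≤ |A - q| := abs_sub_abs_le_abs_sub A q
  have e4 : η * |A| ≤ η * (|q| + ε / 4) := mul_le_mul_of_nonneg_left (by linarith) hη0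
  have e5 : η * (|q| + ε / 4) = η * |q| + η * (ε / 4) := mul_add η |q| (ε / 4)
  have e6 : η * (ε / 4) ≤ ε / 4 := mul_le_of_le_one_left (by linarith) hη1
  linarith

/-! ## Registered stubs (the ONLY `sorry`s of this file) -/

/-- Registered stub 1 — tail limit of every member of the trial family (see `Sig.stub_familyTailLimit`). -/
theorem stub_familyTailLimit : Sig.stub_familyTailLimit := by
  sorry

/-- Registered stub 2 — amplitude shadowing of the ground-state pair correlator by one member, given its tail
limit as a hypothesis (see `Sig.stub_groundStateCone`). -/
theorem stub_groundStateCone : Sig.stub_groundStateCone := by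
  sorry

/-! ## The composition: the two stub signatures imply the crux, BY NAME (sorry-free) -/

/-- **`RVBShadowing_of` — THE SKELETON THEOREM**: `Sig.stub_familyTailLimit → Sig.stub_groundStateCone →`
`Summit.HubbardSuperconductivity.HubbardSuperconductivity.Theses.ProjectedBCSGas.RVBShadowing`, a real proof (axioms `propext`,
`Classical.choice`, `Quot.sound` only). Take `(U, δ, g, Δv, μ, η)` from stub 2; stub 1 at `(g, Δv, μ, δ)` gives the
member's tail limit `A`; feed it to stub 2; for `ε > 0` use stub 2 at `ε/2` and stub 1 at `ε/4` beyond
`max R₁ R₂`, `max L₁ L₂`, and close with `cone_triangle`: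
`|G_ψ - G_χ| ≤ |G_ψ - A| + |A - G_χ| ≤ η|A| + ε/2 + ε/4 ≤ η(|G_χ| + ε/4) + 3ε/4 ≤ η|G_χ| + ε`. The crux's inline
`let χ := fun L => …` is `trialState g Δv μ δ` after one δ-unfolding, so the stub inequalities apply to the crux's
goal as they stand. Every stub is consumed. [folklore] -/
theorem RVBShadowing_of :
    Sig.stub_familyTailLimit → Sig.stub_groundStateCone →
      Summit.HubbardSuperconductivity.HubbardSuperconductivity.Theses.ProjectedBCSGas.RVBShadowing := by
  intro hflat hconeAll
  obtain ⟨U, hU, δ, hδ, g, hg, Δv, hΔv, μ, hμ, η, ⟨hη0, hη1⟩, hcone⟩ := hconeAll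
  obtain ⟨A, hA⟩ := hflat g hg Δv hΔv μ hμ δ hδ
  have hc := hcone A hA
  refine ⟨U, hU, δ, hδ, g, hg, Δv, hΔv, μ, hμ, η, ⟨hη0, hη1⟩, fun ε hε => ?_⟩
  obtain ⟨R₁, L₁, h1⟩ := hc (ε / 2) (by positivity)
  obtain ⟨R₂, L₂, h2⟩ := hA (ε / 4) (by positivity)
  refine ⟨max R₁ R₂, max L₁ L₂, fun N ψ hyp L hLe hL x y hxy => ?_⟩
  exact cone_triangle hη0 hη1.le hε.le
    (h1 N ψ hyp L hLe ((le_max_left _ _).trans hL) x y ((le_max_left _ _).trans hxy))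
    (h2 L hLe ((le_max_right _ _).trans hL) x y ((le_max_right _ _).trans hxy))

/-- The skeleton in its final shape: the crux BY NAME from the two registered stubs; it becomes the crux proof when
the last `stub_*` is discharged (until then it depends on `sorryAx` through the stubs only — no `sorry` of its
own). [folklore] -/
theorem RVBShadowing_proof :
    Summit.HubbardSuperconductivity.HubbardSuperconductivity.Theses.ProjectedBCSGas.RVBShadowing :=
  RVBShadowing_of stub_familyTailLimit stub_groundStateCone

end Summit.HubbardSuperconductivity.HubbardSuperconductivity.Cruxes.RVBShadowing.Birth

end
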